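import Summits.QuantumFields.YangMills.Theorems.IR.Negative.BlockedActivityOnsetFalse
import Summits.QuantumFields.YangMills.Theorems.IR.BlockedActivityOnsetCal
import Summits.QuantumFields.YangMills.Theorems.BrascampLiebVacuumSC.Negative.AdmissibleInstance

/-!
# Crux `IR` (stmt-QuantumFields-19354), lane B — companion of `Negative/BlockedActivityOnsetFalse` (O-112): the simply-connected input
# DISCHARGED, and the NT-calibrated σ-uniform statement by name (refuter `ym-19354-disprove-1` g9, Negative∕ lane, `--supports` only)

`SimplyConnectedSpace SU(2)` is a THEOREM of the tree (`Theorems.BrascampLiebVacuumSC.Negative.simplyConnectedSpace_su2`, unit quaternions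
`S³ ≃ SU(2)`); that module imports the `ConvexGribovBody` route file, so the discharge is isolated here (Theses-cone hygiene) and the main
module stays in the cone of `Theorems.IR.BlockedActivityUnivShellCond`.

* `not_blockedActivityOnsetSC : ¬ BlockedActivityOnsetSC` — **lane B's σ-uniform construction statement (`Theorems/IR/BlockedActivityDefs`,
  p527934) is FALSE, unconditionally** (witness: `SU(2)`, fundamental, the central point-gauge flip of `Negative/BlockedActivityOnsetFalse`).
* `not_blockedActivityOnsetCalSC_of_lowerBounds : (∃ a, (∀ β, 0 < a β) ∧ a → 0 ∧ LowerBounds SU(2) fund a) → ¬ BlockedActivityOnsetCalSC` —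
  the NT-CALIBRATED σ-uniform statement (`Theorems/IR/BlockedActivityOnsetCal`, owner R100 (3)) is false MODULO the existence of one positive
  unit map tending to `0` with the pinning `LowerBounds` on `SU(2)` (fundamental).  That hypothesis is the route's own standing input
  (physics-grade TRUE at the physical unit `a ≍ 1/ξ(β)`; not constructible in the tree), so this is a conditional negative lemma, not a kill:
  the calibration `a β · b < T` is simply never used by the flip (`not_calibratedTail_suN`).

NOT touched (by design): the W-currency `BlockedActivityOnsetAtW ∕ …SCW` (p536391 — the flip moves `σ` on the collar edges `(−eᵢ, i)`, a
different `WindowAgree` class) and the Typ-relativised statements `BlockedActivityTypOnsetCalSC`, `BlockedActivityWorkingClassCalSC` (the class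
may exclude the flipped data at rarity cost).  HONEST FRAMING: negative lemmas on typed supplier currencies of ONE open stub of a CONDITIONAL
reduction; they refute no registered stub of the slot «sharp merge I♯_SC» (sha16 28967a1bf60ad397), prove no gap and nothing about Clay.
Sorry-free; axioms `propext`, `Classical.choice`, `Quot.sound`.
-/

set_option autoImplicit false

open Filter Topology
open Literature.MathematicalPhysics.QuantumFieldTheory Literature.MathematicalPhysics.QuantumLattice
open Summit.QuantumFields.YangMills.Cruxes.OSLegsFromFemtoAndGap.DlrCollarTransfer (LowerBounds)
open Summit.QuantumFields.YangMills.Theorems.BrascampLiebVacuumSC.Negative (simplyConnectedSpace_su2)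

namespace Summit.QuantumFields.YangMills.Cruxes.IR.BlockedActivity

/-- **`¬ BlockedActivityOnsetSC`, UNCONDITIONAL** (O-112 at `SU(2)`, fundamental; SC input = the tree's `simplyConnectedSpace_su2`). -/
theorem not_blockedActivityOnsetSC : ¬ BlockedActivityOnsetSC :=
  not_blockedActivityOnsetSC_of_sc simplyConnectedSpace_su2

/-- **The NT-calibrated σ-uniform statement is false modulo ONE NT unit map with `LowerBounds` on `SU(2)`**:
`(∃ a, (∀ β, 0 < a β) ∧ Tendsto a atTop (𝓝 0) ∧ LowerBounds SU(2) (fundamentalLatticeRep 2) a) → ¬ BlockedActivityOnsetCalSC`. -/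
theorem not_blockedActivityOnsetCalSC_of_lowerBounds
    (hLB : ∃ a : ℝ → ℝ, (∀ β, 0 < a β) ∧ Tendsto a atTop (𝓝 0) ∧
      LowerBounds (Matrix.specialUnitaryGroup (Fin 2) ℂ) (fundamentalLatticeRep 2) a) :
    ¬ BlockedActivityOnsetCalSC := by
  rintro h
  obtain ⟨a, ha, hat, hlb⟩ := hLB
  exact not_calibratedTail_suN le_rfl a
    (h (Matrix.specialUnitaryGroup (Fin 2) ℂ)
      (isCompactSimpleLieGroup_specialUnitaryGroup isSimpleCompactGroup_specialUnitaryGroup_holds le_rfl)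
      simplyConnectedSpace_su2 (fundamentalLatticeRep 2) a ha hat hlb)

end Summit.QuantumFields.YangMills.Cruxes.IR.BlockedActivity
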